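import Summits.MatrixMultiplication.OmegaCensus.STPPSmallPatternKernelReflect122H

/-!
# ω-census, small STPP pattern `(1,2,2)^k`: min-flag reflection theorems, `c'₀ ≠ 0` form

HONEST FRAMING (pub-omega census; verbatim): lottery ticket; floor = certified bounds/negative ranges.
Census STRUCTURE bookkeeping of the STPP track (seat pub-omega-stpp-3, gen 25; STRUCTURE row B5, column `T2`), not progress on `ω`.

The stabiliser-cover hypothesis of `not_exists_isSTPP_122_of_search2r[_stab2]` (`…Reflect122R/H.lean`) quantifies over every
`z : G`, so the pair `(d, 0)` — which is the start of no model (`c'₀ ≠ c₀`) but passes the literal tests of the engine — had to be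
certified, and its relaxed search is `false` (`ℤ/32`) or enormous (`(ℤ/2)⁵`).  The theorems here add the escape `mkS j z = 0` to
the cover (kernel-trivial maps: `z = 0`), discharged inside the proof by `c₀ = 0 ≠ c'₀`:
`not_exists_isSTPP_122_of_search2rZ_stab2` (with the second stabiliser level) and its corollary
`not_exists_isSTPP_122_of_search2rZ` (plain `(b₁, b'₁)` cover).

References: H. Cohn, R. Kleinberg, B. Szegedy, C. Umans, FOCS 2005 (arXiv:math/0511460), Def. 5.1.  Record: pub-omega HOME
`pub-omega-stpp-3-g25/`.
-/

namespace Summit.MatrixMultiplication.OmegaCensus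

namespace STPP122Neg

open STPP211Neg Literature.Computability.AlgebraicComplexity

section Refl

variable {G : Type} [AddCommGroup G] {E : GEnc G} {K : ℕ}

/-- **REFLECTION THROUGH DEF. 5.1 — MIN-FLAG NORMAL FORM WITH A SECOND STABILISER LEVEL** (pattern `(1,2,2)^k`, `k ≥ 2`): as
`not_exists_isSTPP_122_of_search2r_stab2`, but the stabiliser cover may dismiss `z` with `mkS j z = 0` (no model has `c'₀ = c₀`;
the unrestricted form forced a certificate for the non-start `(d, 0)`), and with, for every certified start `s`, a list `IH s` of maps `mkH j` that are additive,
kernel-trivial, rank-preserving and FIX BOTH ELEMENTS OF THE START; the chunk masks of the start then need only cover the pairs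
`(minCode x, v₂)` — the least code in the orbit of `x` under `IH s`, any `b'₁`-code `v₂`.  [cite: CohnKleinbergSzegedyUmans2005, Def. 5.1] -/
theorem not_exists_isSTPP_122_of_search2rZ_stab2 [DecidableEq G] (E : GEnc G) (hK : 2 ≤ K) (cls : List ℕ)
    (hneg : ∀ u v : G, prk E cls (-u) v = prk E cls u v ∧ prk E cls u (-v) = prk E cls u v)
    {reps : List ℕ} {ι κ κ' : Type*} (mkA : ι → G → G) (IA : List ι)
    (haddA : ∀ i ∈ IA, ∀ a b : G, mkA i (a + b) = mkA i a + mkA i b) (hkerA : ∀ i ∈ IA, ∀ x : G, mkA i x = 0 → x = 0)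
    (hcover : ∀ d : G, d ≠ 0 → ∃ i ∈ IA, E.enc (mkA i d) ∈ reps)
    (hprA : ∀ i ∈ IA, ∀ u v : G, prk E cls (mkA i u) (mkA i v) = prk E cls u v)
    (mkS : κ → G → G) (IS : List κ)
    (haddS : ∀ j ∈ IS, ∀ a b : G, mkS j (a + b) = mkS j a + mkS j b) (hkerS : ∀ j ∈ IS, ∀ x : G, mkS j x = 0 → x = 0)
    (hprS : ∀ j ∈ IS, ∀ u v : G, prk E cls (mkS j u) (mkS j v) = prk E cls u v)
    (mkH : κ' → G → G) (IH : ℕ × ℕ → List κ')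
    {starts : List (ℕ × ℕ)}
    (hH : ∀ s ∈ starts, ∀ j ∈ IH s, (∀ a b : G, mkH j (a + b) = mkH j a + mkH j b) ∧ (∀ x : G, mkH j x = 0 → x = 0) ∧
      (∀ u v : G, prk E cls (mkH j u) (mkH j v) = prk E cls u v) ∧
      ∀ d w : G, E.enc d = s.1 → E.enc w = s.2 → mkH j d = d ∧ mkH j w = w)
    (hstab : ∀ d : G, E.enc d ∈ reps → ∀ z : G, ∃ j ∈ IS, mkS j d = d ∧
      (mkS j z = 0 ∨ prk E cls (mkS j z) d < prk E cls d (mkS j z) ∨ (E.enc d, E.enc (mkS j z)) ∈ starts))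
    (hcov : ∀ s ∈ starts, ∃ ch : List (ℕ × ℕ × ℕ × ℕ × ℕ × ℕ × ℕ), search2r E.g K ch = true ∧
      (∀ e ∈ ch, e.1 = s.1 ∧ e.2.1 = s.2 ∧ ∀ u < E.g.n, ∀ v < E.g.n,
        (0 < u ∧ 0 < v ∧ prank cls (e.1 * E.g.n + e.2.1) ≤ prank cls (u * E.g.n + v) ∧
          prank cls (e.1 * E.g.n + e.2.1) ≤ prank cls (v * E.g.n + u)) →
        e.2.2.2.2.1.testBit u = false ∧ e.2.2.2.2.2.1.testBit v = false ∧ e.2.2.2.2.2.2.testBit (u * E.g.n + v) = false) ∧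
      ∀ x : G, ∀ v₂ < E.g.n, ∃ e ∈ ch, e.2.2.1.testBit (minCode E mkH (IH s) x) = false ∧ e.2.2.2.1.testBit v₂ = false) :
    ¬ ∃ A B C : Fin K → Finset G, IsSTPP A B C ∧ ∀ i, (A i).card = 1 ∧ (B i).card = 2 ∧ (C i).card = 2 := by
  have hK1 : 0 < K := by omega
  rw [exists_isSTPP_122_iff]
  rintro ⟨p, p', q, q', hb, hc, hU, hX⟩
  have hM : ModelD2 p p' q q' := modelD2_of_finsetForm hb hc hU hX
  -- homs from the parametrised maps
  have haddLA : ∀ f ∈ IA.map mkA, ∀ a b : G, f (a + b) = f a + f b := fun f hf => by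
    obtain ⟨i, hi, rfl⟩ := List.mem_map.1 hf; exact haddA i hi
  have haddLS : ∀ f ∈ IS.map mkS, ∀ a b : G, f (a + b) = f a + f b := fun f hf => by
    obtain ⟨j, hj, rfl⟩ := List.mem_map.1 hf; exact haddS j hj
  set LA : List (G →+ G) := (IA.map mkA).attach.map fun x => AddMonoidHom.mk' x.1 (haddLA x.1 x.2)
  set LS : List (G →+ G) := (IS.map mkS).attach.map fun x => AddMonoidHom.mk' x.1 (haddLS x.1 x.2)
  have memLA : ∀ i ∈ IA, ∃ φ ∈ LA, ⇑φ = mkA i := fun i hi =>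
    exists_mem_attach_map haddLA (List.mem_map.2 ⟨i, hi, rfl⟩)
  have memLS : ∀ j ∈ IS, ∃ φ ∈ LS, ⇑φ = mkS j := fun j hj =>
    exists_mem_attach_map haddLS (List.mem_map.2 ⟨j, hj, rfl⟩)
  have hinjA : ∀ φ ∈ LA, Function.Injective φ := fun φ hφ => by
    obtain ⟨f, hf, hφf⟩ := coe_mem_of_mem_attach_map hφ
    obtain ⟨i, hi, rfl⟩ := List.mem_map.1 hf
    rw [hφf]; exact injective_of_additive_of_ker (haddA i hi) (hkerA i hi)
  have hinjS : ∀ φ ∈ LS, Function.Injective φ := fun φ hφ => by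
    obtain ⟨f, hf, hφf⟩ := coe_mem_of_mem_attach_map hφ
    obtain ⟨j, hj, rfl⟩ := List.mem_map.1 hf
    rw [hφf]; exact injective_of_additive_of_ker (haddS j hj) (hkerS j hj)
  have hprLA : ∀ φ ∈ LA, ∀ u v, prk E cls (φ u) (φ v) = prk E cls u v := fun φ hφ u v => by
    obtain ⟨f, hf, hφf⟩ := coe_mem_of_mem_attach_map hφ
    obtain ⟨i, hi, rfl⟩ := List.mem_map.1 hf
    rw [hφf]; exact hprA i hi u v
  have hprLS : ∀ φ ∈ LS, ∀ u v, prk E cls (φ u) (φ v) = prk E cls u v := fun φ hφ u v => by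
    obtain ⟨f, hf, hφf⟩ := coe_mem_of_mem_attach_map hφ
    obtain ⟨j, hj, rfl⟩ := List.mem_map.1 hf
    rw [hφf]; exact hprS j hj u v
  have hcoverA : ∀ d : G, d ≠ 0 → ∃ φ ∈ LA, E.enc (φ d) ∈ reps := fun d hd => by
    obtain ⟨i, hi, h⟩ := hcover d hd
    obtain ⟨φ, hφ, hφf⟩ := memLA i hi
    exact ⟨φ, hφ, by rw [hφf]; exact h⟩
  -- the min-flag normal form
  obtain ⟨r, r', s, s', hMr, hNF, hr0, hs0, -, hgood, hle⟩ := exists_normalForm2_rank E hM hK1 (prk E cls)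
    (fun u v => (hneg u v).1) (fun u v => (hneg u v).2) hinjA hcoverA hprLA hinjS hprLS
    (good := fun y w => w = 0 ∨ prank cls (w * E.g.n + y) < prank cls (y * E.g.n + w) ∨ (y, w) ∈ starts) (fun d hd z => by
      obtain ⟨j, hj, hjd, hrest⟩ := hstab d hd z
      obtain ⟨ψ, hψ, hψg⟩ := memLS j hj
      refine ⟨ψ, hψ, by rw [hψg]; exact hjd, ?_⟩
      rw [hψg]
      rcases hrest with h0 | hrest
      · exact Or.inl (by rw [h0, E.enc_zero])
      · exact Or.inr hrest)
  set i0 : Fin K := ⟨0, hK1⟩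
  rcases hgood with h0 | hlt | hmem
  · -- `c'₀ = 0 = c₀`: impossible in a model
    have : s' i0 = 0 := E.enc_inj (h0.trans E.enc_zero.symm)
    exact absurd (hs0.trans this.symm) (hMr.2.1 i0)
  · have h := (hle i0).2
    rw [hr0, hs0, sub_zero, sub_zero] at h
    exact absurd hlt (not_lt.2 h)
  · -- second stabiliser level at the certified start
    set st : ℕ × ℕ := (E.enc (r' i0), E.enc (s' i0))
    have hHs := hH st hmem
    obtain ⟨t, t', u, u', hMt, hNFt, ht0, hu0, ht'0, hu'0, hlet, x, hx⟩ := exists_NF2_minCode E hMr hK hr0 hs0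
      (prk E cls) (fun u v => (hneg u v).1) (fun u v => (hneg u v).2) hle mkH (IH st) (fun j hj => (hHs j hj).1)
      (fun j hj => (hHs j hj).2.1) (fun j hj => (hHs j hj).2.2.1) (fun j hj => (hHs j hj).2.2.2 _ _ rfl rfl)
    obtain ⟨ch, hsearch, hall, hcover2⟩ := hcov st hmem
    obtain ⟨e, he, hx1, hx2⟩ := hcover2 x (E.enc (t' ⟨1, hK⟩)) (E.enc_lt _)
    obtain ⟨he1, he2, had'⟩ := hall e he
    have had : Adequate E.g.n cls e := fun u hu0 hu v hv0 hv h1 h2 => had' u hu v hv ⟨hu0, hv0, h1, h2⟩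
    have he1' : e.1 = E.enc (t' i0) := by rw [he1, ht'0]
    have he2' : e.2.1 = E.enc (u' i0) := by rw [he2, hu'0]
    have hP : PairOK E e.2.2.2.2.1 e.2.2.2.2.2.1 e.2.2.2.2.2.2 t t' u u' := pairOK_of_adequate hMt hK1 hlet he1' he2' had
    rw [← hx] at hx1
    have := start2r_of_search2r hsearch e he
    rw [he1', he2', start2r_false hMt hNFt hP hK ht0 hu0 hx1 hx2] at this
    exact Bool.false_ne_true this


/-- **REFLECTION THROUGH DEF. 5.1 — MIN-FLAG NORMAL FORM, `c'₀ ≠ 0` form, plain `(b₁, b'₁)` cover** (no second stabiliser level):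
corollary of `not_exists_isSTPP_122_of_search2rZ_stab2` with empty stabiliser lists. [cite: CohnKleinbergSzegedyUmans2005, Def. 5.1] -/
theorem not_exists_isSTPP_122_of_search2rZ [DecidableEq G] (E : GEnc G) (hK : 2 ≤ K) (cls : List ℕ)
    (hneg : ∀ u v : G, prk E cls (-u) v = prk E cls u v ∧ prk E cls u (-v) = prk E cls u v)
    {reps : List ℕ} {ι κ : Type*} (mkA : ι → G → G) (IA : List ι)
    (haddA : ∀ i ∈ IA, ∀ a b : G, mkA i (a + b) = mkA i a + mkA i b) (hkerA : ∀ i ∈ IA, ∀ x : G, mkA i x = 0 → x = 0)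
    (hcover : ∀ d : G, d ≠ 0 → ∃ i ∈ IA, E.enc (mkA i d) ∈ reps)
    (hprA : ∀ i ∈ IA, ∀ u v : G, prk E cls (mkA i u) (mkA i v) = prk E cls u v)
    (mkS : κ → G → G) (IS : List κ)
    (haddS : ∀ j ∈ IS, ∀ a b : G, mkS j (a + b) = mkS j a + mkS j b) (hkerS : ∀ j ∈ IS, ∀ x : G, mkS j x = 0 → x = 0)
    (hprS : ∀ j ∈ IS, ∀ u v : G, prk E cls (mkS j u) (mkS j v) = prk E cls u v)
    {starts : List (ℕ × ℕ)}
    (hstab : ∀ d : G, E.enc d ∈ reps → ∀ z : G, ∃ j ∈ IS, mkS j d = d ∧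
      (mkS j z = 0 ∨ prk E cls (mkS j z) d < prk E cls d (mkS j z) ∨ (E.enc d, E.enc (mkS j z)) ∈ starts))
    (hcov : ∀ s ∈ starts, ∃ ch : List (ℕ × ℕ × ℕ × ℕ × ℕ × ℕ × ℕ), search2r E.g K ch = true ∧
      (∀ e ∈ ch, e.1 = s.1 ∧ e.2.1 = s.2 ∧ ∀ u < E.g.n, ∀ v < E.g.n,
        (0 < u ∧ 0 < v ∧ prank cls (e.1 * E.g.n + e.2.1) ≤ prank cls (u * E.g.n + v) ∧
          prank cls (e.1 * E.g.n + e.2.1) ≤ prank cls (v * E.g.n + u)) →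
        e.2.2.2.2.1.testBit u = false ∧ e.2.2.2.2.2.1.testBit v = false ∧ e.2.2.2.2.2.2.testBit (u * E.g.n + v) = false) ∧
      ∀ v₁ < E.g.n, ∀ v₂ < E.g.n, ∃ e ∈ ch, e.2.2.1.testBit v₁ = false ∧ e.2.2.2.1.testBit v₂ = false) :
    ¬ ∃ A B C : Fin K → Finset G, IsSTPP A B C ∧ ∀ i, (A i).card = 1 ∧ (B i).card = 2 ∧ (C i).card = 2 :=
  not_exists_isSTPP_122_of_search2rZ_stab2 E hK cls hneg mkA IA haddA hkerA hcover hprA mkS IS haddS hkerS hprS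
    (fun (_ : Unit) (x : G) => x) (fun _ => []) (fun _ _ _ hj => by simp at hj) hstab (fun s hs => by
      obtain ⟨ch, h1, h2, h3⟩ := hcov s hs
      exact ⟨ch, h1, h2, fun x v₂ hv₂ => h3 (E.enc x) (E.enc_lt x) v₂ hv₂⟩)

end Refl

end STPP122Neg

end Summit.MatrixMultiplication.OmegaCensus
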